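import Mathlib
import HarnessLib
import Summits.HubbardSuperconductivity.HubbardSuperconductivity.Theorems.KLProgrammeKLRegimeEnginePairTransferRelResExport

/-!
# Route `KLProgramme` — ENGINE child gen 8 (stmt-HubbardSuperconductivity-20437 `KLRegimeEngineV17F2`), class #5 rev 3 — THE ALL-Qm SPINE (cell STATUS (R247), regime (β) producer of record):
# the EXPORT of the guard-generic private family to the RAW relative family — `pairTransferRelFamilyK5_of_relResIdx_all`, `pairTransferRelFamilyK5_of_relResIdx_fifth_all`
# (cell gate-hubbard-kl, seat hubbard-kl-k3c1-p1 g16; CLASS5-RESOLVED-STEP.md §14 / KLTC-INDEX v12 §S)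

WHY.  `pairTransferRelFamilyK5_of_relResIdx` (…RelResIdx) and `…_fifth` (…RelResExport) conclude Export5's `PairTransferRelFamilyK5 … n`, whose `PairTransferRelAt`
carries the pair-class guard IN ITS DEFINITION.  The all-Qm spine needs the same export with the guard generic and the conclusion RAW (the body of
`PairTransferRelAt`: a two-sided inverse `N` of `1 − diag(tₙ[s_{n,m}] − tₙ[s_{n,m′}])·A°ₙ[s_{n,m′}]` and `‖A°ₙ[s_{n,m}] − A°ₙ[s_{n,m′}]·N‖ ≤ transferBarRelIdx … n m′ Qm` on the bare ball,
for every pair `n ≤ m′ ≤ m ≤ n_β+1` and every `Qm` with `C L Qm n`) — exactly the triple k3c2-p2's class-agnostic consumer `member_sub_plain_le_of_relData` eats.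
Guard-generic plumbing over landed doors (token move `IsPairClassAt L Qm ↦ C L Qm`, `C` any ANTITONE guard; the all-Qm family is `C := fun _ _ _ => True`, the in-class family
`C := fun L Qm n => IsPairClassAt L Qm n`); nothing about the model's sizes is asserted; nothing asserts (X).3, (c), K3 or superconductivity.  0 kit · 0 lit.
-/

noncomputable section

namespace Summit.HubbardSuperconductivity.HubbardSuperconductivity.Theorems.KLRegimeSplit

set_option linter.dupNamespace false -- summit = problem name (single-conjunct summit), D-0017

open Finset Matrix Literature.MathematicalPhysics.QuantumLattice Literature.Probability.LatticeModels
open Summit.HubbardSuperconductivity.HubbardSuperconductivity.Theorems.KLProgrammeLegKernels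
open Summit.HubbardSuperconductivity.HubbardSuperconductivity.Theorems.DispersionFlow
open Summit.HubbardSuperconductivity.HubbardSuperconductivity.Theorems.EngineV8

/-! ## §1 Numerics -/

section ExportAll

variable (L M : ℕ) [NeZero L] [NeZero M]

/-- **`pairTransferRelFamilyK5_of_relResIdx_all`** — EXPORT of the guard-generic private family at scale `n` to the RAW relative family (Export5's `PairTransferRelFamilyK5 … n`
with `PairTransferRelAt` unfolded and the pair-class guard replaced by `C L Qm n`; one two-sided-inverse conversion per `Qm`, `kltc_fwd_of_relResidue`). -/
theorem pairTransferRelFamilyK5_of_relResIdx_all (C : ∀ L : ℕ, TorusSite 2 L → ℕ → Prop) (_hC : ∀ (L : ℕ) (Qm : TorusSite 2 L) (j n : ℕ), j ≤ n → C L Qm n → C L Qm j) {G : GeoConsts} {P : SplitConsts} {r β U μ : ℝ} {n : ℕ} {mA : ℝ} (hm : 0 ≤ mA)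
    {RB : ℕ → ℕ → ℕ → TorusSite 2 L → TorusSite 2 L → TorusSite 2 L → ℝ}
    (hhist : ∀ j j' : ℕ, n ≤ j' → j' ≤ j → j ≤ nScales β + 1 → ∀ Qm : TorusSite 2 L, C L Qm n →
      ∀ k ∈ klBall L μ 0, ∀ k' ∈ klBall L μ 0,
      ‖(klMemberArrayF L M β U μ n (softSymbolCompl L M β μ (klFlowFrameU L M β U μ n) n j) Qm + klMemberArrayF L M β U μ n (softSymbolCompl L M β μ (klFlowFrameU L M β U μ n) n j) Qm *
          diagonal (fun c => -(((klTransferWeight L M β μ (klFlowFrameU L M β U μ n) n (softSymbolCompl L M β μ (klFlowFrameU L M β U μ n) n j) Qm c -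
            klTransferWeight L M β μ (klFlowFrameU L M β U μ n) n (softSymbolCompl L M β μ (klFlowFrameU L M β U μ n) n j') Qm c : ℝ)) : ℂ)) * klMemberArrayF L M β U μ n (softSymbolCompl L M β μ (klFlowFrameU L M β U μ n) n j') Qm -
          klMemberArrayF L M β U μ n (softSymbolCompl L M β μ (klFlowFrameU L M β U μ n) n j') Qm) k k'‖ ≤ RB n j j' Qm k k')
    (hexp : ∀ j j' : ℕ, n ≤ j' → j' ≤ j → j ≤ nScales β + 1 → ∀ Qm : TorusSite 2 L, C L Qm n →
      (∀ x y, ‖klMemberArrayF L M β U μ n (softSymbolCompl L M β μ (klFlowFrameU L M β U μ n) n j') Qm x y‖ ≤ mA) ∧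
      mA * ∑ c, ‖(-(((klTransferWeight L M β μ (klFlowFrameU L M β U μ n) n (softSymbolCompl L M β μ (klFlowFrameU L M β U μ n) n j) Qm c -
          klTransferWeight L M β μ (klFlowFrameU L M β U μ n) n (softSymbolCompl L M β μ (klFlowFrameU L M β U μ n) n j') Qm c : ℝ)) : ℂ))‖ ≤ 1 / 3 ∧
      (∀ k ∈ klBall L μ 0, ∀ k' ∈ klBall L μ 0, RB n j j' Qm k k' + ∑ c, (if k ∈ klBall L μ 0 ∧ c ∈ klBall L μ 0 then RB n j j' Qm k c else 0) *
          ‖(-(((klTransferWeight L M β μ (klFlowFrameU L M β U μ n) n (softSymbolCompl L M β μ (klFlowFrameU L M β U μ n) n j) Qm c -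
            klTransferWeight L M β μ (klFlowFrameU L M β U μ n) n (softSymbolCompl L M β μ (klFlowFrameU L M β U μ n) n j') Qm c : ℝ)) : ℂ))‖ * (3 / 2 * mA) ≤
          transferBarRelIdx L G P r β U n j' Qm k k')) :
    ∀ m m' : ℕ, n ≤ m' → m' ≤ m → m ≤ nScales β + 1 → ∀ Qm : TorusSite 2 L, C L Qm n →
    ∃ N : Matrix (TorusSite 2 L) (TorusSite 2 L) ℂ,
      (1 - diagonal (fun p => ((klTransferWeight L M β μ (klFlowFrameU L M β U μ n) n (softSymbolCompl L M β μ (klFlowFrameU L M β U μ n) n m) Qm p -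
          klTransferWeight L M β μ (klFlowFrameU L M β U μ n) n (softSymbolCompl L M β μ (klFlowFrameU L M β U μ n) n m') Qm p : ℝ) : ℂ)) * klMemberArrayF L M β U μ n (softSymbolCompl L M β μ (klFlowFrameU L M β U μ n) n m') Qm) * N = 1 ∧
      N * (1 - diagonal (fun p => ((klTransferWeight L M β μ (klFlowFrameU L M β U μ n) n (softSymbolCompl L M β μ (klFlowFrameU L M β U μ n) n m) Qm p -
          klTransferWeight L M β μ (klFlowFrameU L M β U μ n) n (softSymbolCompl L M β μ (klFlowFrameU L M β U μ n) n m') Qm p : ℝ) : ℂ)) * klMemberArrayF L M β U μ n (softSymbolCompl L M β μ (klFlowFrameU L M β U μ n) n m') Qm) = 1 ∧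
      ∀ k ∈ klBall L μ 0, ∀ k' ∈ klBall L μ 0,
        ‖klMemberArrayF L M β U μ n (softSymbolCompl L M β μ (klFlowFrameU L M β U μ n) n m) Qm k k' - (klMemberArrayF L M β U μ n (softSymbolCompl L M β μ (klFlowFrameU L M β U μ n) n m') Qm * N) k k'‖ ≤ transferBarRelIdx L G P r β U n m' Qm k k' := by
  intro j j' h1 h2 h3 Qm hQm
  obtain ⟨hA, hsm, hbud⟩ := hexp j j' h1 h2 h3 Qm hQm
  -- the residue bound, globally (zero off the ball)
  have hT : ∀ x y, ‖(klMemberArrayF L M β U μ n (softSymbolCompl L M β μ (klFlowFrameU L M β U μ n) n j) Qm + klMemberArrayF L M β U μ n (softSymbolCompl L M β μ (klFlowFrameU L M β U μ n) n j) Qm *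
      diagonal (fun c => -(((klTransferWeight L M β μ (klFlowFrameU L M β U μ n) n (softSymbolCompl L M β μ (klFlowFrameU L M β U μ n) n j) Qm c -
        klTransferWeight L M β μ (klFlowFrameU L M β U μ n) n (softSymbolCompl L M β μ (klFlowFrameU L M β U μ n) n j') Qm c : ℝ)) : ℂ)) * klMemberArrayF L M β U μ n (softSymbolCompl L M β μ (klFlowFrameU L M β U μ n) n j') Qm -
      klMemberArrayF L M β U μ n (softSymbolCompl L M β μ (klFlowFrameU L M β U μ n) n j') Qm) x y‖ ≤ (fun x y => if x ∈ klBall L μ 0 ∧ y ∈ klBall L μ 0 then RB n j j' Qm x y else 0) x y := by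
    intro x y
    show _ ≤ (if x ∈ klBall L μ 0 ∧ y ∈ klBall L μ 0 then RB n j j' Qm x y else 0)
    by_cases hxy : x ∈ klBall L μ 0 ∧ y ∈ klBall L μ 0
    · rw [if_pos hxy]; exact hhist j j' h1 h2 h3 Qm hQm x hxy.1 y hxy.2
    · rw [if_neg hxy, kltc_relResidue_eq_zero_off _ _ _ (klBall L μ 0) (fun x y h => klMemberArrayF_eq_zero_off β U μ n _ Qm h)
        (fun x y h => klMemberArrayF_eq_zero_off β U μ n _ Qm h) hxy, norm_zero]
  obtain ⟨N, e1, e2, hR⟩ := kltc_fwd_of_relResidue _ _ _ _ hm hA hsm hT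
  rw [← kltc_one_sub_diag_eq_one_add_diag_neg] at e1 e2
  refine ⟨N, e1, e2, fun k hk k' hk' => ?_⟩
  have hb := hR k k'
  rw [Matrix.sub_apply] at hb
  refine hb.trans ?_
  have hkk : k ∈ klBall L μ 0 ∧ k' ∈ klBall L μ 0 := ⟨hk, hk'⟩
  rw [if_pos hkk]
  exact hbud k hk k' hk'

/-- **`pairTransferRelFamilyK5_of_relResIdx_fifth_all`** (guard-generic, RAW conclusion; twin of `pairTransferRelFamilyK5_of_relResIdx_fifth`) — the Ẽ-organisation's EXPORT with the conversion row DISCHARGED: the private relative-residue family of the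
cutoff-built pairs at scale `n` with bars `θ·transferBarRelIdx L G P r β U n j′ Qm` (`0 ≤ θ ≤ 1/5`) on the bare ball, the a priori size `|A°ₙ[s_{n,j′}]| ≤ mA`, the U-door
row `mA·(4·15367) ≤ 1/3`, the frame binders (`FrameOK` of `Kₙ`, `klBetaMin ≤ β ≤ L`, `π/L ≤ Λₙ`) and `0 ≤ r`, `0 ≤ P.Klam`, `0 ≤ G.CF` ⟹ the RAW relative family at scale `n` under the guard `C`. -/
theorem pairTransferRelFamilyK5_of_relResIdx_fifth_all (C : ∀ L : ℕ, TorusSite 2 L → ℕ → Prop) (hC : ∀ (L : ℕ) (Qm : TorusSite 2 L) (j n : ℕ), j ≤ n → C L Qm n → C L Qm j) {R : RenConsts} {N : ℕ} {G : GeoConsts} (hCF : 0 ≤ G.CF) {P : SplitConsts} (hKl : 0 ≤ P.Klam)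
    {r β U μ : ℝ} (hr : 0 ≤ r) {n : ℕ} (hKf : FrameOK R U N μ (klFlowFrameU L M β U μ n)) (hβ : klBetaMin ≤ β) (hβL : β ≤ L)
    (hη₀ : Real.pi / (L : ℝ) ≤ klScale klE0 n) {mA : ℝ} (hm : 0 ≤ mA) (hsm : mA * (4 * 15367) ≤ 1 / 3) {θ : ℝ} (hθ0 : 0 ≤ θ) (hθ : θ ≤ 1 / 5)
    (hhist : ∀ j j' : ℕ, n ≤ j' → j' ≤ j → j ≤ nScales β + 1 → ∀ Qm : TorusSite 2 L, C L Qm n →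
      ∀ k ∈ klBall L μ 0, ∀ k' ∈ klBall L μ 0,
      ‖(klMemberArrayF L M β U μ n (softSymbolCompl L M β μ (klFlowFrameU L M β U μ n) n j) Qm + klMemberArrayF L M β U μ n (softSymbolCompl L M β μ (klFlowFrameU L M β U μ n) n j) Qm *
          diagonal (fun c => -(((klTransferWeight L M β μ (klFlowFrameU L M β U μ n) n (softSymbolCompl L M β μ (klFlowFrameU L M β U μ n) n j) Qm c -
            klTransferWeight L M β μ (klFlowFrameU L M β U μ n) n (softSymbolCompl L M β μ (klFlowFrameU L M β U μ n) n j') Qm c : ℝ)) : ℂ)) * klMemberArrayF L M β U μ n (softSymbolCompl L M β μ (klFlowFrameU L M β U μ n) n j') Qm -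
          klMemberArrayF L M β U μ n (softSymbolCompl L M β μ (klFlowFrameU L M β U μ n) n j') Qm) k k'‖ ≤ θ * transferBarRelIdx L G P r β U n j' Qm k k')
    (hA : ∀ j' : ℕ, n ≤ j' → j' ≤ nScales β + 1 → ∀ Qm : TorusSite 2 L, C L Qm n →
      ∀ x y, ‖klMemberArrayF L M β U μ n (softSymbolCompl L M β μ (klFlowFrameU L M β U μ n) n j') Qm x y‖ ≤ mA) :
    ∀ m m' : ℕ, n ≤ m' → m' ≤ m → m ≤ nScales β + 1 → ∀ Qm : TorusSite 2 L, C L Qm n →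
    ∃ N : Matrix (TorusSite 2 L) (TorusSite 2 L) ℂ,
      (1 - diagonal (fun p => ((klTransferWeight L M β μ (klFlowFrameU L M β U μ n) n (softSymbolCompl L M β μ (klFlowFrameU L M β U μ n) n m) Qm p -
          klTransferWeight L M β μ (klFlowFrameU L M β U μ n) n (softSymbolCompl L M β μ (klFlowFrameU L M β U μ n) n m') Qm p : ℝ) : ℂ)) * klMemberArrayF L M β U μ n (softSymbolCompl L M β μ (klFlowFrameU L M β U μ n) n m') Qm) * N = 1 ∧
      N * (1 - diagonal (fun p => ((klTransferWeight L M β μ (klFlowFrameU L M β U μ n) n (softSymbolCompl L M β μ (klFlowFrameU L M β U μ n) n m) Qm p -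
          klTransferWeight L M β μ (klFlowFrameU L M β U μ n) n (softSymbolCompl L M β μ (klFlowFrameU L M β U μ n) n m') Qm p : ℝ) : ℂ)) * klMemberArrayF L M β U μ n (softSymbolCompl L M β μ (klFlowFrameU L M β U μ n) n m') Qm) = 1 ∧
      ∀ k ∈ klBall L μ 0, ∀ k' ∈ klBall L μ 0,
        ‖klMemberArrayF L M β U μ n (softSymbolCompl L M β μ (klFlowFrameU L M β U μ n) n m) Qm k k' - (klMemberArrayF L M β U μ n (softSymbolCompl L M β μ (klFlowFrameU L M β U μ n) n m') Qm * N) k k'‖ ≤ transferBarRelIdx L G P r β U n m' Qm k k' := by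
  refine pairTransferRelFamilyK5_of_relResIdx_all L M C hC hm (RB := fun _ _ j' Qm k k' => θ * transferBarRelIdx L G P r β U n j' Qm k k') hhist ?_
  intro j j' h1 h2 h3 Qm hQm
  refine ⟨hA j' h1 (h2.trans h3) Qm hQm, ?_, fun k _ k' _ => ?_⟩
  · -- `mA·Σ_c |tₙ[s_j](c) − tₙ[s_j′](c)| ≤ 1/3` from the U-door row
    have h := mul_sum_abs_klTransferWeight_compl_sub_le_third (M := M) β μ (klFlowFrameU L M β U μ n) hKf hβ hβL h1 h2 Qm hm hsm
    refine le_of_eq_of_le ?_ h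
    congr 1
    refine Finset.sum_congr rfl fun c _ => ?_
    rw [norm_neg, Complex.norm_real, Real.norm_eq_abs]
  · exact klam_exportRow_le β μ (klFlowFrameU L M β U μ n) hKf hβ hβL hCF hKl hr h1 h2 hη₀ hm hsm hθ0 hθ (klBall L μ 0) Qm Qm k k'

end ExportAll

end Summit.HubbardSuperconductivity.HubbardSuperconductivity.Theorems.KLRegimeSplit

end
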